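import Summits.Parity.GeneralizedHardyLittlewood.Theorems.GreenTaoLevelTwoMNTwoSectionEight

/-!
# Route `GreenTaoLevelTwo`, crux `MNTwo` (stmt-Parity-21276), line `birth`, stub `stub_mnVertical`:
# GT 2008b Theorem 4 from Proposition 19 — complex-valued `F`

Block V3 of the `stub_mnVertical` census (B. Green, T. Tao, *Quadratic uniformity of the Möbius
function*, Ann. Inst. Fourier 58 (2008) = arXiv:math/0606087, §8), complex-valued form of
`…MNTwoSectionEight.sum_moebius_localQuadratic_le` ("We may assume that `ψ` is real": split
`F = Re F + i Im F`; the phase is locally quadratic on `{F ≠ 0} ⊇ {Re F ≠ 0}, {Im F ≠ 0}`).  Def-free: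

* `sum_moebius_localQuadratic_complex_le` — for `F : ℝᵏ → ℂ` `ℤᵏ`-periodic, `1`-bounded,
  `M`-Lipschitz (sup-distance) and `φ` locally quadratic on `{1 ≤ n ≤ N : F(x+nα) ≠ 0}`:
  `‖∑_{n ≤ N} μ(n) F(x+nα) e(−φ(n))‖ ≤ C M N / log^A N`, given Proposition 19 (hypothesis `hP`).

References: [GreenTao2008QuadraticMobius] arXiv:math/0606087, Thm. 4, Prop. 19, §8.
-/

noncomputable section

open Finset Real ArithmeticFunction
open scoped FourierTransform ArithmeticFunction.Moebius

namespace Summit.Parity.GeneralizedHardyLittlewood.GreenTaoLevelTwoMNTwoSectionEightComplex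

open Summit.Parity.GeneralizedHardyLittlewood.GreenTaoLevelTwoMNTwoSectionEight

/-- **GT 2008b Theorem 4 from Proposition 19, complex-valued `F` on `[1, N]`.**
[cite: GreenTao2008QuadraticMobius, Theorem 4 and §8] -/
theorem sum_moebius_localQuadratic_complex_le (k : ℕ)
    (hP : ∀ A : ℝ, 0 < A → ∃ C : ℝ, ∀ N : ℕ, 2 ≤ N → ∀ (α : Fin k → ℝ) (n₀ : ℤ) (ρ : ℝ),
      0 < ρ → 100000 * ρ < 1 →
      (∀ n : ℤ, ((∀ i, ‖((((n - n₀ : ℤ) : ℝ) * α i : ℝ) : AddCircle (1 : ℝ))‖ +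
          |((n - n₀ : ℤ) : ℝ)| / N < 100 * ρ) ∧ |((n - n₀ : ℤ) : ℝ)| / N < 100 * ρ) →
        (N : ℤ) < n ∧ n ≤ 2 * N) →
      ∀ φ : ℤ → ℝ,
        (∀ n h₁ h₂ h₃ : ℤ,
          (∀ e₁ e₂ e₃ : ℕ, e₁ ≤ 1 → e₂ ≤ 1 → e₃ ≤ 1 →
            (∀ i, ‖((((n + e₁ * h₁ + e₂ * h₂ + e₃ * h₃ - n₀ : ℤ) : ℝ) * α i : ℝ) :
                AddCircle (1 : ℝ))‖ +
              |((n + e₁ * h₁ + e₂ * h₂ + e₃ * h₃ - n₀ : ℤ) : ℝ)| / N < 100 * ρ) ∧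
            |((n + e₁ * h₁ + e₂ * h₂ + e₃ * h₃ - n₀ : ℤ) : ℝ)| / N < 100 * ρ) →
          ∃ z : ℤ, φ (n + h₁ + h₂ + h₃) - φ (n + h₁ + h₂) - φ (n + h₁ + h₃) - φ (n + h₂ + h₃)
            + φ (n + h₁) + φ (n + h₂) + φ (n + h₃) - φ n = z) →
        ∀ ψ : ℤ → ℝ, (∀ n, 0 ≤ ψ n) →
          (∀ n, ψ n ≠ 0 →
            (∀ i, ‖((((n - n₀ : ℤ) : ℝ) * α i : ℝ) : AddCircle (1 : ℝ))‖ +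
                |((n - n₀ : ℤ) : ℝ)| / N < ρ) ∧ |((n - n₀ : ℤ) : ℝ)| / N < ρ) →
          (∀ (n n' : ℤ) (t : ℝ), 0 ≤ t →
            (∀ i, ‖((((n - n' : ℤ) : ℝ) * α i : ℝ) : AddCircle (1 : ℝ))‖ ≤ t) →
              |ψ n - ψ n'| ≤ t + |((n - n' : ℤ) : ℝ)| / N) →
          ‖∑ n ∈ Ioc N (2 * N), ((μ n : ℝ) : ℂ) * ((ψ n : ℝ) : ℂ) * (𝐞 (-(φ n)) : ℂ)‖ ≤
            C * N / Real.log N ^ A)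
    {A : ℝ} (hA : 0 < A) :
    ∃ C : ℝ, ∀ M : ℝ, 1 ≤ M → ∀ F : (Fin k → ℝ) → ℂ,
      (∀ y (i : Fin k), F (y + Pi.single i 1) = F y) → (∀ y, ‖F y‖ ≤ 1) →
      (∀ y y', ‖F y - F y'‖ ≤ M * dist y y') →
      ∀ N : ℕ, 2 ≤ N → ∀ (α x : Fin k → ℝ) (φ : ℤ → ℝ),
        (∀ n h₁ h₂ h₃ : ℤ,
          (∀ e₁ e₂ e₃ : ℕ, e₁ ≤ 1 → e₂ ≤ 1 → e₃ ≤ 1 →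
            (1 : ℤ) ≤ n + e₁ * h₁ + e₂ * h₂ + e₃ * h₃ ∧ n + e₁ * h₁ + e₂ * h₂ + e₃ * h₃ ≤ N ∧
              F (x + ((n + e₁ * h₁ + e₂ * h₂ + e₃ * h₃ : ℤ) : ℝ) • α) ≠ 0) →
          ∃ z : ℤ, φ (n + h₁ + h₂ + h₃) - φ (n + h₁ + h₂) - φ (n + h₁ + h₃) - φ (n + h₂ + h₃)
            + φ (n + h₁) + φ (n + h₂) + φ (n + h₃) - φ n = z) →
        ‖∑ n ∈ Icc 1 N, ((μ n : ℝ) : ℂ) * F (x + (n : ℝ) • α) * (𝐞 (-(φ n)) : ℂ)‖ ≤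
          C * M * N / Real.log N ^ A := by
  obtain ⟨C, hC⟩ := sum_moebius_localQuadratic_le k hP hA
  refine ⟨2 * C, ?_⟩
  intro M hM F hFper hF1 hFlip N hN α x φ hφ
  -- real and imaginary parts
  have hre := hC M hM (fun y => (F y).re) (fun y i => by simp [hFper])
    (fun y => (Complex.abs_re_le_norm _).trans (hF1 y))
    (fun y y' => by
      rw [← Complex.sub_re]
      exact (Complex.abs_re_le_norm _).trans (hFlip y y'))
    N hN α x φ (fun n h₁ h₂ h₃ hc => hφ n h₁ h₂ h₃ fun e₁ e₂ e₃ he₁ he₂ he₃ => by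
      obtain ⟨h1, h2, h3⟩ := hc e₁ e₂ e₃ he₁ he₂ he₃
      exact ⟨h1, h2, fun h => h3 (by rw [h, Complex.zero_re])⟩)
  have him := hC M hM (fun y => (F y).im) (fun y i => by simp [hFper])
    (fun y => (Complex.abs_im_le_norm _).trans (hF1 y))
    (fun y y' => by
      rw [← Complex.sub_im]
      exact (Complex.abs_im_le_norm _).trans (hFlip y y'))
    N hN α x φ (fun n h₁ h₂ h₃ hc => hφ n h₁ h₂ h₃ fun e₁ e₂ e₃ he₁ he₂ he₃ => by
      obtain ⟨h1, h2, h3⟩ := hc e₁ e₂ e₃ he₁ he₂ he₃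
      exact ⟨h1, h2, fun h => h3 (by rw [h, Complex.zero_im])⟩)
  have hsplit : ∑ n ∈ Icc 1 N, ((μ n : ℝ) : ℂ) * F (x + (n : ℝ) • α) * (𝐞 (-(φ n)) : ℂ) =
      ∑ n ∈ Icc 1 N, ((μ n : ℝ) : ℂ) * (((F (x + (n : ℝ) • α)).re : ℝ) : ℂ) * (𝐞 (-(φ n)) : ℂ) +
      Complex.I * ∑ n ∈ Icc 1 N, ((μ n : ℝ) : ℂ) * (((F (x + (n : ℝ) • α)).im : ℝ) : ℂ) *
        (𝐞 (-(φ n)) : ℂ) := by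
    rw [mul_sum, ← sum_add_distrib]
    refine sum_congr rfl fun n _ => ?_
    conv_lhs => rw [← Complex.re_add_im (F (x + (n : ℝ) • α))]
    ring
  rw [hsplit]
  calc ‖∑ n ∈ Icc 1 N, ((μ n : ℝ) : ℂ) * (((F (x + (n : ℝ) • α)).re : ℝ) : ℂ) * (𝐞 (-(φ n)) : ℂ) +
        Complex.I * ∑ n ∈ Icc 1 N, ((μ n : ℝ) : ℂ) * (((F (x + (n : ℝ) • α)).im : ℝ) : ℂ) *
          (𝐞 (-(φ n)) : ℂ)‖
      ≤ ‖∑ n ∈ Icc 1 N, ((μ n : ℝ) : ℂ) * (((F (x + (n : ℝ) • α)).re : ℝ) : ℂ) * (𝐞 (-(φ n)) : ℂ)‖ +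
        ‖Complex.I * ∑ n ∈ Icc 1 N, ((μ n : ℝ) : ℂ) * (((F (x + (n : ℝ) • α)).im : ℝ) : ℂ) *
          (𝐞 (-(φ n)) : ℂ)‖ := norm_add_le _ _
    _ ≤ C * M * N / Real.log N ^ A + C * M * N / Real.log N ^ A := by
        rw [norm_mul, Complex.norm_I, one_mul]
        exact add_le_add hre him
    _ = 2 * C * M * N / Real.log N ^ A := by ring

end Summit.Parity.GeneralizedHardyLittlewood.GreenTaoLevelTwoMNTwoSectionEightComplex
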